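import Mathlib
import Summits.Ventures.HodgeRepro.LitRank
import Summits.Ventures.HodgeRepro.LitRankChar
import Summits.Ventures.HodgeRepro.LitRankCyclic
import Summits.Ventures.HodgeRepro.LitRankYanai
import Summits.Ventures.HodgeRepro.KubotaLit2

/-!
# LitRankHolds — the printed facts of `LitRank.lean` discharged unconditionally

Blind cell `pub-hodge-repro`, seat lit-2 (gen 3).  Assembles the conditional discharges of
`LitRankChar.lean`, `LitRankCyclic.lean` and `LitRankYanai.lean` (same seat) with seat typer-2's
`Kubota_rank_abelian_charFormula_holds` (`KubotaLit2.lean`, Kubota's character formula proved on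
Mathlib):

* `Kubota1965_lemma2_holds` — Kubota 1965, Lemma 2 (defect form), as printed;
* `Yanai1985_lemma_cyclic_nondegenerate_holds` — Yanai 1985, Lemma p.171 (cyclic order `2d`,
  `d` an odd prime: every simple CM-type is nondegenerate);
* `Yanai1985_theorem_prime_nondegenerate_holds` — Yanai 1985, Theorem p.171 (= Dodson 1987
  Thm 1.0 (v), Ribet): every simple CM-type of prime dimension is nondegenerate
  (`LitRankYanai.lean`, same seat).

Both are `theorem <Fact>_holds : <Fact>` for the named facts `def <Fact> : Prop` of `LitRank.lean`
(the facts stay `def`s; users' `(h : Fact)` are fed `Fact_holds`).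
-/

namespace HodgeRepro.Lit2

/-- **Kubota 1965, Lemma 2, holds** (defect form, as printed p.119). -/
theorem Kubota1965_lemma2_holds : Kubota1965_lemma2 :=
  Kubota1965_lemma2_of_charFormula Kubota_rank_abelian_charFormula_holds

/-- **Yanai 1985, Lemma p.171, holds**: every simple CM-type on a cyclic group of order `2d`,
`d` an odd prime, is nondegenerate. -/
theorem Yanai1985_lemma_cyclic_nondegenerate_holds : Yanai1985_lemma_cyclic_nondegenerate :=
  Yanai1985_lemma_cyclic_nondegenerate_of_charFormula Kubota_rank_abelian_charFormula_holds

/-- **Yanai 1985, Theorem p.171, holds** (Ribet's nondegeneracy theorem): every simple CM-type of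
prime dimension is nondegenerate. -/
theorem Yanai1985_theorem_prime_nondegenerate_holds : Yanai1985_theorem_prime_nondegenerate :=
  Yanai1985_theorem_prime_nondegenerate_of_charFormula Kubota_rank_abelian_charFormula_holds

end HodgeRepro.Lit2
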